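import Literature.AlgebraicGeometry.Frobenioids.ArchimedeanHalfCircleLifts
import Mathlib.Analysis.Complex.Polynomial.Basic
import HarnessLib

/-!
# Frobenioids II, Proposition 3.4 (iii): the half-circle witness, arbitrary Frobenius degree
# (abc-iut cell, layer L1, node `FrdII:Prop3.4(iii)`, chain LC-L1-2 — `C₀`-level part for `F = A`)

Mochizuki, *The geometry of Frobenioids II: poly-Frobenioids*, Kyushu J. Math. **62** (2008)
401–460, §3, Proposition 3.4 (iii) p. 30, proof p. 31. [cite: MochizukiFrdII2008, Prop 3.4 (iii) p.30]

PROOF-ONLY file (nothing defined), continuing `ArchimedeanHalfCircleLifts.lean`: the `C₀`-level facts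
needed to run the half-circle witness `φ₀ = (Spec ℂ → Spec ℝ, 1, i)` against test arrows of ARBITRARY
Frobenius degree `d` (the angular Frobenioid `A` contains non-linear isometries):
* `mul_mem_arcDir_one`, `arcDir_one_pow_subset` — products of points of small arcs around `1` stay in
  an arc (`arg` is additive while the sum stays in `(−π, π]`), so `(arcDir 1 ε)^d ⊆ arcDir 1 (dε)`;
* `exists_mem_im_pow_ne_zero` — an open nonempty `U ⊆ S¹` contains `z` with `Im(v z^d) ≠ 0`;
* `C0.image_galAct_halfCircle_carrier` — the region of the witness object is stable under both twists;
* `C0.exists_lift_pair_real`, `C0.exists_lift_pair_deg` — joint lifts of a degree-`d` test arrow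
  `γ₀ : W → (Spec ℝ, [0,1])` and of `φ₀` from a small arc object `V` around `1`: for `W` real,
  `δ₁ = (id, d, 1) : V → X`, `δ₂ = (Spec ℂ → Spec ℝ, 1, c₂)` with `c₂^d = i / c_γ`; for `W` complex,
  `δ₁ = (τ, d, τ(i)⁻¹ c_γ z₁^d)`, `δ₂ = (id, 1, z₁)`.
No side is taken on [IUTchIII] Cor. 3.12.
-/

namespace Literature.AlgebraicGeometry.Frobenioids

open CategoryTheory Set
open scoped Pointwise

noncomputable section

namespace ArchFrd

namespace C0

/-- The region of the witness object (angular part the right half-circle) is stable under both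
Galois twists. [cite: MochizukiFrdII2008, Def 3.1 (iv) p.24] -/
theorem image_galAct_halfCircle_carrier {X : C0} (hX : X.region.dir = arcDir 1 (Real.pi / 2))
    (σ : Bool) : D0.galAct σ '' X.region.carrier = X.region.carrier := by
  have key : ∀ u : ℂˣ, D0.galAct σ u ∈ X.region.carrier ↔ u ∈ X.region.carrier := by
    intro u
    show (unitPart ℂ (D0.galAct σ u) ∈ X.region.dir ∧ absHom ℂ (D0.galAct σ u) ≤ X.region.tip) ↔
      (unitPart ℂ u ∈ X.region.dir ∧ absHom ℂ u ≤ X.region.tip)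
    rw [hX, mem_arcDir_one_iff, mem_arcDir_one_iff, re_unitPart_pos_iff, re_unitPart_pos_iff,
      re_galAct, absHom_galAct]
  ext u
  constructor
  · rintro ⟨x, hx, rfl⟩
    exact (key x).mpr hx
  · intro hu
    exact ⟨D0.galAct σ u, (key u).mpr hu, D0.galAct_galAct σ u⟩

/-- **Fiberwise-surjectivity, real test objects, any degree** (`C₀` level): for `W` real and an
isometry `γ₀ : W → (Spec ℝ, [0,1])` of degree `d`, the arc object `V` of half-width `π/(2d)` and tip
`1` carries `δ₁ = (id, d, 1) : V → X` and `δ₂ = (Spec ℂ → Spec ℝ, 1, c₂) : V → W`, `c₂^d = i/c_γ`, with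
`φ₀ ∘ δ₁ = γ₀ ∘ δ₂`. [cite: MochizukiFrdII2008, Prop 3.4 (iii) p.30] -/
theorem exists_lift_pair_real {RW : AngularRegion ℂ} (hRW : D0.real = D0.real → RW.IsIsotropic)
    (γ : C0.mk D0.real RW hRW ⟶ realOfTip 1) (hγI : PreFrobenioid.IsIsometry toElem γ)
    {RX : AngularRegion ℂ} (hRX : D0.complex = D0.real → RX.IsIsotropic)
    (hRXd : RX.dir = arcDir 1 (Real.pi / 2)) (hRXt : RX.tip = 1)
    (φ : C0.mk D0.complex RX hRX ⟶ realOfTip 1) (hφd : degFr φ = 1)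
    (hφs : scalar φ = Units.mk0 Complex.I Complex.I_ne_zero) :
    ∃ (RV : AngularRegion ℂ) (hRV : D0.complex = D0.real → RV.IsIsotropic)
      (δ₁ : C0.mk D0.complex RV hRV ⟶ C0.mk D0.complex RX hRX)
      (δ₂ : C0.mk D0.complex RV hRV ⟶ C0.mk D0.real RW hRW),
      Base δ₁ = 𝟙 D0.complex ∧ PreFrobenioid.IsIsometry toElem δ₁ ∧
        PreFrobenioid.IsIsometry toElem δ₂ ∧ δ₁ ≫ φ = δ₂ ≫ γ := by
  have hγt : ‖((scalar γ : ℂˣ) : ℂ)‖ * (RW.tip : ℝ) ^ (degFr γ : ℕ) = 1 := (A0.isIsometry_iff_norm_mul_tip_pow γ).mp hγI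
  have hcpos : 0 < ‖((scalar γ : ℂˣ) : ℂ)‖ := norm_pos_iff.mpr (scalar γ).ne_zero
  have hc0 : ((scalar γ : ℂˣ) : ℂ) ≠ 0 := (scalar γ).ne_zero
  have hdpos : (0 : ℝ) < (degFr γ : ℕ) := by exact_mod_cast (degFr γ).pos
  -- the arc object `V` of half-width `π / (2 d)`
  set ε : ℝ := Real.pi / 2 / (degFr γ : ℕ) with hεdef
  have hε : 0 < ε := by positivity
  have hεle : ε ≤ Real.pi / 2 := by
    rw [hεdef, div_le_iff₀ hdpos]
    have : (1 : ℝ) ≤ (degFr γ : ℕ) := by exact_mod_cast (degFr γ).pos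
    nlinarith [Real.pi_pos]
  have hεπ : ε < Real.pi := by linarith [Real.pi_pos]
  let RV : AngularRegion ℂ := arcRegion 1 ε hε hεπ 1
  have hRV : D0.complex = D0.real → RV.IsIsotropic := fun h => nomatch h
  have hnat : (((degFr γ).natPred : ℝ) + 1) = ((degFr γ : ℕ) : ℝ) := by
    exact_mod_cast (degFr γ).natPred_add_one
  have hrad : (((degFr γ).natPred : ℝ) + 1) * ε = Real.pi / 2 := by
    rw [hnat, hεdef]
    field_simp
  -- condition (c) for δ₁ = (id, d, 1)
  have hm₁ : (1 : ℂˣ) • (C0.mk D0.complex RV hRV).region.carrier ^ (degFr γ : ℕ) ⊆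
      pullRegion (C0.mk D0.complex RX hRX) (𝟙 D0.complex) := by
    rw [pullRegion_id, ← (degFr γ).natPred_add_one]
    refine (RV.smul_carrier_pow_subset_iff RX 1 (degFr γ).natPred).mpr ⟨?_, ?_⟩
    · rw [unitPart_one, one_smul, hRXd]
      refine (arcDir_one_pow_subset hε.le _ (by rw [hrad]; linarith [Real.pi_pos])).trans ?_
      rw [hrad]
    · rw [map_one, one_mul, hRXt]
      show (1 : PosReal) ^ ((degFr γ).natPred + 1) ≤ 1
      rw [one_pow]
  -- the scalar `c₂`, a `d`-th root of `i / c_γ`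
  obtain ⟨z, hz⟩ := IsAlgClosed.exists_pow_nat_eq (Complex.I * ((scalar γ : ℂˣ) : ℂ)⁻¹) (degFr γ).pos
  have hz0 : z ≠ 0 := by
    intro h
    rw [h, zero_pow (degFr γ).ne_zero] at hz
    exact (mul_ne_zero Complex.I_ne_zero (inv_ne_zero hc0)) hz.symm
  have hzn : ‖z‖ = (RW.tip : ℝ) := by
    have h1 : ‖z‖ ^ (degFr γ : ℕ) = ‖((scalar γ : ℂˣ) : ℂ)‖⁻¹ := by
      rw [← norm_pow, hz, norm_mul, Complex.norm_I, one_mul, norm_inv]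
    have h2 : (RW.tip : ℝ) ^ (degFr γ : ℕ) = ‖((scalar γ : ℂˣ) : ℂ)‖⁻¹ :=
      eq_inv_of_mul_eq_one_right hγt
    exact (pow_left_inj₀ (norm_nonneg _) RW.tip.2.le (degFr γ).ne_zero).mp (h1.trans h2.symm)
  have hm₂ : Units.mk0 z hz0 • (C0.mk D0.complex RV hRV).region.carrier ^ ((1 : ℕ+) : ℕ) ⊆
      pullRegion (C0.mk D0.real RW hRW) D0.toRealHom := by
    rw [PNat.one_coe, pow_one]
    rintro _ ⟨x, hx, rfl⟩
    show Units.mk0 z hz0 • x ∈ D0.toRealHom.act '' RW.carrier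
    unfold D0.Hom.act
    rw [D0.twists_toRealHom, D0.image_galAct_false, mem_carrier_of_isIsotropic (hRW rfl),
      absHom_le_iff, smul_eq_mul, Units.val_mul, norm_mul, Units.val_mk0, hzn]
    have hx1 : ‖(x : ℂ)‖ ≤ 1 := (absHom_le_iff x (1 : PosReal)).mp hx.2
    calc (RW.tip : ℝ) * ‖(x : ℂ)‖ ≤ (RW.tip : ℝ) * 1 := mul_le_mul_of_nonneg_left hx1 RW.tip.2.le
      _ = _ := mul_one _
  have hmem₂ : Units.mk0 z hz0 ∈ D0.scalars (C0.mk D0.complex RV hRV).base := by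
    show _ ∈ D0.scalars D0.complex
    rw [D0.scalars_complex]
    exact Subgroup.mem_top _
  refine ⟨RV, hRV, ⟨𝟙 D0.complex, degFr γ, 1, one_mem _, hm₁⟩, ⟨D0.toRealHom, 1, _, hmem₂, hm₂⟩,
    rfl, ?_, ?_, ?_⟩
  · rw [A0.isIsometry_iff_norm_mul_tip_pow]
    show ‖((1 : ℂˣ) : ℂ)‖ * ((1 : PosReal) : ℝ) ^ (degFr γ : ℕ) = (RX.tip : ℝ)
    rw [Units.val_one, norm_one, one_mul, Positive.val_one, one_pow, hRXt, Positive.val_one]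
  · rw [A0.isIsometry_iff_norm_mul_tip_pow]
    show ‖z‖ * ((1 : PosReal) : ℝ) ^ ((1 : ℕ+) : ℕ) = (RW.tip : ℝ)
    rw [Positive.val_one, one_pow, mul_one, hzn]
  · refine C0.hom_ext (D0.hom_to_real_eq rfl _ _) ?_ ?_
    · rw [degFr_comp', degFr_comp', hφd, mul_one]
      exact (one_mul _).symm
    · rw [scalar_comp', scalar_comp', hφd, PNat.one_coe, pow_one, hφs]
      show D0.galAct (D0.Hom.twists (𝟙 D0.complex)) (Units.mk0 Complex.I Complex.I_ne_zero) * 1 =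
        D0.galAct (D0.Hom.twists D0.toRealHom) (scalar γ) * Units.mk0 z hz0 ^ (degFr γ : ℕ)
      rw [D0.twists_id, D0.twists_toRealHom, D0.galAct_false, D0.galAct_false, mul_one]
      ext
      rw [Units.val_mk0, Units.val_mul, Units.val_pow_eq_pow_val, Units.val_mk0, hz, mul_comm Complex.I,
        ← mul_assoc, mul_inv_cancel₀ hc0, one_mul]

/-- **Fiberwise-surjectivity, complex test objects, any degree** (`C₀` level): for `W` complex, a
point `z₁` of its angular part with `Re(τ(i)⁻¹ c_γ z₁^d) > 0` (`τ` the twist `σ`, `d` the degree of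
`γ₀`), a small arc object `V` around `1` (tip of `W`) carries isometries
`δ₁ = (τ, d, τ(i)⁻¹ c_γ z₁^d) : V → X` and `δ₂ = (id, 1, z₁) : V → W` with `φ₀ ∘ δ₁ = γ₀ ∘ δ₂`.
[cite: MochizukiFrdII2008, Prop 3.4 (iii) p.30] -/
theorem exists_lift_pair_deg {RW : AngularRegion ℂ} (hRW : D0.complex = D0.real → RW.IsIsotropic)
    (γ : C0.mk D0.complex RW hRW ⟶ realOfTip 1) (hγI : PreFrobenioid.IsIsometry toElem γ)
    {RX : AngularRegion ℂ} (hRX : D0.complex = D0.real → RX.IsIsotropic)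
    (hRXd : RX.dir = arcDir 1 (Real.pi / 2)) (hRXt : RX.tip = 1)
    (φ : C0.mk D0.complex RX hRX ⟶ realOfTip 1) (hφd : degFr φ = 1)
    (hφs : scalar φ = Units.mk0 Complex.I Complex.I_ne_zero)
    (σ : Bool) {z₁ : ↥(normOneSubgroup ℂ)} (hz₁ : z₁ ∈ RW.dir)
    (hre : 0 < ((((D0.galAct σ (Units.mk0 Complex.I Complex.I_ne_zero))⁻¹ * scalar γ *
      (z₁ : ℂˣ) ^ (degFr γ : ℕ) : ℂˣ) : ℂ)).re) :
    ∃ (RV : AngularRegion ℂ) (hRV : D0.complex = D0.real → RV.IsIsotropic)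
      (δ₁ : C0.mk D0.complex RV hRV ⟶ C0.mk D0.complex RX hRX)
      (δ₂ : C0.mk D0.complex RV hRV ⟶ C0.mk D0.complex RW hRW),
      Base δ₁ = D0.Hom.gal σ ∧ Base δ₂ = 𝟙 D0.complex ∧
        PreFrobenioid.IsIsometry toElem δ₁ ∧ PreFrobenioid.IsIsometry toElem δ₂ ∧
        δ₁ ≫ φ = δ₂ ≫ γ := by
  set Iu : ℂˣ := Units.mk0 Complex.I Complex.I_ne_zero with hIu
  set c₁ : ℂˣ := (D0.galAct σ Iu)⁻¹ * scalar γ * (z₁ : ℂˣ) ^ (degFr γ : ℕ) with hc₁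
  have hγt : ‖((scalar γ : ℂˣ) : ℂ)‖ * (RW.tip : ℝ) ^ (degFr γ : ℕ) = 1 := (A0.isIsometry_iff_norm_mul_tip_pow γ).mp hγI
  have hz₁n : ‖(((z₁ : ℂˣ)) : ℂ)‖ = 1 := (mem_normOneSubgroup_iff ℂ _).1 z₁.2
  have hIun : ‖((D0.galAct σ Iu : ℂˣ) : ℂ)‖ = 1 := by
    rw [D0.norm_galAct, hIu, Units.val_mk0, Complex.norm_I]
  have hc₁n : ‖(c₁ : ℂ)‖ = ‖((scalar γ : ℂˣ) : ℂ)‖ := by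
    rw [hc₁, Units.val_mul, Units.val_mul, norm_mul, norm_mul, Units.val_inv_eq_inv_val, norm_inv,
      hIun, Units.val_pow_eq_pow_val, norm_pow, hz₁n, one_pow, inv_one, one_mul, mul_one]
  have hdpos : (0 : ℝ) < (degFr γ : ℕ) := by exact_mod_cast (degFr γ).pos
  have hnat : (((degFr γ).natPred : ℝ) + 1) = ((degFr γ : ℕ) : ℝ) := by
    exact_mod_cast (degFr γ).natPred_add_one
  -- the unit part `p` of `c₁` lies in the right half-circle; choose the arc width
  have hp : unitPart ℂ c₁ ∈ arcDir 1 (Real.pi / 2) := by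
    rw [mem_arcDir_one_iff, re_unitPart_pos_iff]
    exact hre
  obtain ⟨ε₁, hε₁, hε₁π, harc₁⟩ :=
    exists_arcDir_subset (isOpen_arcDir 1 (by linarith [Real.pi_pos])) hp
  obtain ⟨ε₂, hε₂, hε₂π, harc₂⟩ := exists_arcDir_subset RW.isOpen_dir hz₁
  set ε : ℝ := min (ε₁ / (degFr γ : ℕ)) ε₂ with hεdef
  have hε : 0 < ε := lt_min (by positivity) hε₂
  have hεπ : ε < Real.pi := lt_of_le_of_lt (min_le_right _ _) hε₂π
  have hdε : ((degFr γ : ℕ) : ℝ) * ε ≤ ε₁ := by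
    have : ε ≤ ε₁ / (degFr γ : ℕ) := min_le_left _ _
    rw [le_div_iff₀ hdpos] at this
    linarith
  let RV : AngularRegion ℂ := arcRegion 1 ε hε hεπ RW.tip
  have hRV : D0.complex = D0.real → RV.IsIsotropic := fun h => nomatch h
  -- condition (c) for δ₂ = (id, 1, z₁)
  have hm₂ : (z₁ : ℂˣ) • (C0.mk D0.complex RV hRV).region.carrier ^ ((1 : ℕ+) : ℕ) ⊆
      pullRegion (C0.mk D0.complex RW hRW) (𝟙 D0.complex) := by
    rw [PNat.one_coe, pullRegion_id]
    refine (RV.smul_carrier_pow_subset_iff RW (z₁ : ℂˣ) 0).mpr ⟨?_, ?_⟩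
    · rw [zero_add, pow_one, unitPart_normOne_coe]
      exact ((smul_arcDir_one_subset z₁ ε).trans (arcDir_subset_arcDir z₁ (min_le_right _ _))).trans
        harc₂
    · rw [zero_add, pow_one, absHom_coe_normOne, one_mul]
      exact le_rfl
  -- condition (c) for δ₁ = (gal σ, d, c₁)
  have hm₁ : c₁ • (C0.mk D0.complex RV hRV).region.carrier ^ (degFr γ : ℕ) ⊆
      pullRegion (C0.mk D0.complex RX hRX) (D0.Hom.gal σ) := by
    have hpull : pullRegion (C0.mk D0.complex RX hRX) (D0.Hom.gal σ) = RX.carrier := by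
      unfold pullRegion D0.Hom.act
      rw [D0.twists_gal]
      exact image_galAct_halfCircle_carrier (X := C0.mk D0.complex RX hRX) hRXd σ
    rw [hpull, ← (degFr γ).natPred_add_one]
    refine (RV.smul_carrier_pow_subset_iff RX c₁ (degFr γ).natPred).mpr ⟨?_, ?_⟩
    · rw [hRXd]
      have hpow : RV.dir ^ ((degFr γ).natPred + 1) ⊆ arcDir 1 ((((degFr γ).natPred : ℝ) + 1) * ε) :=
        arcDir_one_pow_subset hε.le _ (by rw [hnat]; linarith)
      refine ((Set.smul_set_mono hpow).trans ?_).trans harc₁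
      refine (smul_arcDir_one_subset _ _).trans (arcDir_subset_arcDir _ ?_)
      rw [hnat]
      exact hdε
    · rw [← Subtype.coe_le_coe, Positive.val_mul, Positive.val_pow, coe_absHom, hc₁n,
        (degFr γ).natPred_add_one, hRXt, Positive.val_one, ← hγt]
      exact le_rfl
  have hmemX : c₁ ∈ D0.scalars (C0.mk D0.complex RV hRV).base := by
    show _ ∈ D0.scalars D0.complex
    rw [D0.scalars_complex]
    exact Subgroup.mem_top _
  have hmemW : (z₁ : ℂˣ) ∈ D0.scalars (C0.mk D0.complex RV hRV).base := by
    show _ ∈ D0.scalars D0.complex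
    rw [D0.scalars_complex]
    exact Subgroup.mem_top _
  refine ⟨RV, hRV, ⟨D0.Hom.gal σ, degFr γ, c₁, hmemX, hm₁⟩, ⟨𝟙 D0.complex, 1, (z₁ : ℂˣ), hmemW, hm₂⟩,
    rfl, rfl, ?_, ?_, ?_⟩
  · rw [A0.isIsometry_iff_norm_mul_tip_pow]
    show ‖(c₁ : ℂ)‖ * (RW.tip : ℝ) ^ (degFr γ : ℕ) = (RX.tip : ℝ)
    rw [hc₁n, hγt, hRXt, Positive.val_one]
  · rw [A0.isIsometry_iff_norm_mul_tip_pow]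
    show ‖((z₁ : ℂˣ) : ℂ)‖ * (RW.tip : ℝ) ^ ((1 : ℕ+) : ℕ) = (RW.tip : ℝ)
    rw [PNat.one_coe, pow_one, hz₁n, one_mul]
  · refine C0.hom_ext (D0.hom_to_real_eq rfl _ _) ?_ ?_
    · rw [degFr_comp', degFr_comp', hφd, mul_one, one_mul]
    · rw [scalar_comp', scalar_comp', hφd, PNat.one_coe, pow_one, hφs]
      show D0.galAct (D0.Hom.twists (D0.Hom.gal σ)) Iu * c₁ =
        D0.galAct (D0.Hom.twists (𝟙 D0.complex)) (scalar γ) * (z₁ : ℂˣ) ^ (degFr γ : ℕ)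
      rw [D0.twists_gal, D0.twists_id, D0.galAct_false, hc₁, ← mul_assoc, ← mul_assoc,
        mul_inv_cancel, one_mul]

end C0

end ArchFrd

end

end Literature.AlgebraicGeometry.Frobenioids
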